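import Literature.Probability.RandomPlanarGeometry.LaceExpansionPiN
import Literature.Probability.LatticeModels.PolylineWinding
import Mathlib.Analysis.SpecialFunctions.Complex.Log
import Mathlib.Data.Matrix.Basic
import HarnessLib

/-!
# The twisted (parafermionic) lace coefficients of the planar self-avoiding walk

Topic `Literature/Probability/RandomPlanarGeometry`; definition request `defn-twistedLaceCoefficient`
(route `CriticalPhenomena/SAWScalingLimit/SAWTwistedSelfEnergy`, item `stmt-CriticalPhenomena-17872`,
card `twisted-self-energy-half-cr`), next to `SAWParafermion.lean` (the parafermionic weight
`e^{-iσW}`) and to the untwisted lace-expansion layer `LaceExpansionGraphs/Laces/Recursion/PiN.lean`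
(graphs, `K[a,b]`, `J[a,b]`, laces `ℒ[0,m]`, compatible edges `𝒞(L)`, `π_m^{(N)} = piN`), which
this file extends by DIRECTION LABELS and COMPLEX TURN WEIGHTS.

## The object

The lace expansion of Brydges–Spencer is pure algebra in the interaction: Slade 2006, §3.2,
"Suppose that to each walk `ω` and each pair `s, t` we are given a complex number `𝒰_{st}(ω)`",
(3.9) `J[a,b] = Σ_{Γ ∈ 𝓖[a,b]} ∏_{st ∈ Γ} 𝒰_{st}`, (3.19)/(3.21)–(3.23)
`J[0,m] = Σ_{L ∈ ℒ[0,m]} ∏_{st ∈ L} 𝒰_{st} ∏_{s't' ∈ 𝒞(L)} (1 + 𝒰_{s't'})`,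
`π_m^{(N)}(x) = Σ_{ω ∈ 𝒲_m(x)} Σ_{L ∈ ℒ^{(N)}[0,m]} ∏_{st ∈ L} (-𝒰_{st}) ∏_{s't' ∈ 𝒞(L)} (1 + 𝒰_{s't'})`,
`π_m = Σ_N (-1)^N π_m^{(N)}` (3.25); Madras–Slade 1993, (5.2.10), (5.2.14). What changes with the
REFERENCE walk is only the walk sum `Σ_ω` and its weight. For a NON-BACKTRACKING (memory-2)
reference system the two-point function and the coefficients become vectors/matrices indexed by
step directions `ι, κ ∈ {±1, …, ±d}` — the non-backtracking lace expansion (NoBLE) of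
Fitzner–van der Hofstad, (1.25): `G_z(x) = G_z^ι(x) + μ_z G_z^{-ι}(x - e_ι)
+ Σ_y Σ_κ Π_z^{ι,κ}(y) G_z^κ(x - y + e_κ) + Ξ^ι(x)`, with the matrix `(Π̂_z(k))_{ι,κ} = Π̂_z^{ι,κ}(k)`
(1.29), "`G_z^ι` the two-point function of the model where `e_ι` is being avoided … in the first
step" (§1.3).

Here the reference system is the planar walk with the COMPLEX MEMORY-2 WEIGHT of the
parafermionic observable (Duminil-Copin–Smirnov 2012, Def. 1; `SAWParafermion.lean`): an `n`-step
nearest-neighbour walk `ω : 0 → z` on `ℤ²`, given a FICTITIOUS INCOMING DIRECTION `ι` (a virtual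
vertex `ω(-1) = -e_ι`), carries the weight `e^{-iσ W_ι(ω)}`, `W_ι(ω)` = the total turning of the
polyline `-e_ι, ω(0), …, ω(n)` (`LatticeModels.winding`; the turn at `ω(0)` between `e_ι` and the
first step is included), and the walk is required to be non-backtracking INCLUDING the fictitious
step (`ω(1) ≠ -e_ι`, `ω(i+2) ≠ ω(i)`); its LAST STEP `e_κ` is recorded as the column index. The
weight is multiplicative under concatenation exactly in these labels (the second piece has
fictitious incoming direction = last step of the first piece), which is what makes the algebra of
§3.2 go through with `4 × 4` matrix products in place of scalar products.

## Contents (namespace `Literature.Probability.RandomPlanarGeometry.LaceExpansion`)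

* `stepDir : Fin 4 → ℤ²` (E, N, W, S — the enumeration `dir` of the route's items),
  `twistedStepMatrix σ = T_σ` (`T_σ(a,b) = 𝟙[e_b ≠ -e_a] e^{-iσ θ(a→b)}`), `polyline`,
  `twistedWinding ι n ω = W_ι(ω)`, `twistedWeight σ ι n ω = e^{-iσ W_ι(ω)}`;
* `nbWalkFun ι κ n z` — the `n`-step non-backtracking (incl. fictitious step `ι`) nearest-neighbour
  walks `0 → z` with last step `e_κ`, as vertex functions (a sub-`Finset` of `walkFun 2 n z`);
* **`twistedLaceCoefficientN σ N n z : Matrix (Fin 4) (Fin 4) ℂ`** = `Π^{σ,(N)}_n(z)`, entry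
  `(ι,κ)` = `Σ_{ω ∈ nbWalkFun ι κ n z} e^{-iσW_ι(ω)} Σ_{L ∈ ℒ^{(N)}[0,n]} ∏_{st∈L} 𝟙[ω(s)=ω(t)]
  ∏_{s't'∈𝒞(L)} (1 - 𝟙[ω(s')=ω(t')])` ((3.23) with the twisted walk sum);
* **`twistedLaceCoefficient σ n z`** = `Π^σ_n(z)` = the SIGNED lace sum, entry `(ι,κ)` =
  `Σ_ω e^{-iσW_ι(ω)} Σ_{L ∈ ℒ[0,n]} ∏_{st ∈ L} U_{st} ∏_{s't' ∈ 𝒞(L)} (1 + U_{s't'})`,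
  `U_{st} = -𝟙[ω(s) = ω(t)]` (the tree's `interaction 1 ω`);
* `twistedTwoPoint σ n z = G^σ_n(z)`: entry `(ι,κ)` = the same walk sum of `e^{-iσW_ι} K[0,n]`
  (`K[0,n] = 𝟙[ω self-avoiding]`), i.e. over `n`-step SAWs `0 → z` with first step `≠ -e_ι` and
  last step `e_κ`; `G_0(z) = δ_{0,z} I` — the object the coefficients expand (the `G` of the route's
  items, there written with Mathlib walks);
* PROVED API: `twistedLaceCoefficient_apply` (`= Σ_ω e^{-iσW} J[0,n]`, resummation (3.19)),
  `twistedLaceCoefficient_eq_sum` ((3.25): `Π^σ_n = Σ_{N ≤ n} (-1)^N Π^{σ,(N)}_n`),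
  `norm_twistedWeight` (`= 1`), `norm_twistedLaceCoefficientN_le_piN`
  (`‖Π^{σ,(N)}_n(z)(ι,κ)‖ ≤ π_n^{(N)}(z)`, the untwisted simple-random-walk-reference coefficient
  `piN 2 1 N n z`: diagrammatic bounds transfer), support `…_eq_zero_of_notMem_box`
  (`Π^σ_n(z) = 0` for `z ∉ {-n,…,n}²`), `twistedLaceCoefficient_zero/one` (`Π^σ_0 = Π^σ_1 = 0`).

## The identity these coefficients are made for (not proved in this file)

With `D(y)(ι,λ) := T_σ(ι,λ) 𝟙[y = e_λ] = G^σ_1(y)`, the derivation of Slade (3.14) (Lemma 3.4 at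
`[0,n]`, then the two factorisations "first step" and "at time `m`", now with the labels `ι, κ`
threaded through the matrix products) gives, for `n ≥ 1`, the TWISTED NoBLE IDENTITY
`G^σ_n(z) = Σ_y D(y) G^σ_{n-1}(z - y) + Σ_{m=2}^{n} Σ_y Π^σ_m(y) G^σ_{n-m}(z - y)` (matrix products,
the earlier piece on the LEFT), equivalently `Ĝ = E + x D ⋆ Ĝ + Π̂ ⋆ Ĝ` as formal power series in
the length variable `x`; by the mirror image of Lemma 3.4 also `G_n = G_{n-1} ⋆ D + Σ_m G_{n-m} ⋆ Π_m`
(everything on the RIGHT) with the SAME `Π^σ` (left and right inverses of `E - xD - Π̂` agree).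
Caveat for users: the mixed recursion `G_n = G_{n-1} ⋆ D + Σ_m K_m ⋆ G_{n-m}` (free step appended
at the end, kernel at the beginning) defines a DIFFERENT kernel, `K̂ = Π̂ + x (DĜ - ĜD) Ĝ⁻¹`, and
`DĜ ≠ ĜD` from order `x⁵` on (`(D G_4 - G_4 D)(e₀)(0,0) = 2 cos 2πσ`); `K_m = Π^σ_m` for `m ≤ 4`
only.

## Design choices

* `d = 2`, directions `Fin 4`, matrices `Matrix (Fin 4) (Fin 4) ℂ`, spin `σ : ℝ` free (the route
  uses `σ = 5/8`), exactly the shape of the route's items; walks as vertex functions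
  (`walkFun`, the coding of the untwisted layer; the route's Mathlib walks `p` correspond under
  `p ↦ p.getVert`, `walkFun` being that image).
* The lace factors are the REAL ones of `piN` (`interaction 1 ω`, values `0, ±1`) cast to `ℂ`, so
  that `Π^{σ,(N)}` is literally "`piN` with the walk sum twisted"; only the weight is complex.
* Non-backtracking is imposed on the walk sum (reference system), not through the interaction:
  laces containing an edge `(s, s+2)` then contribute `0`, as do odd edges (`ℤ²` is bipartite).
* `n = 0`: no walk has a last step, so `Π^σ_0 = 0 = Π^{σ,(N)}_0` (there is no lace on `[0,0]`
  either), while `G^σ_0 := δ_{0,z} I` by definition.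
-/

noncomputable section

open Finset Literature.Probability.LatticeModels Literature.Probability.RandomPlanarGeometry.SAW.Zd
open scoped BigOperators

namespace Literature.Probability.RandomPlanarGeometry.LaceExpansion

/-! ### Directions, the twisted step matrix and the twisted weight -/

/-- The four lattice directions of `ℤ²`: `e₀ = (1,0)`, `e₁ = (0,1)`, `e₂ = (-1,0)`, `e₃ = (0,-1)`
(E, N, W, S; the enumeration `dir` of the items of route `SAWTwistedSelfEnergy`). [folklore] -/
def stepDir : Fin 4 → Site 2 := ![![1, 0], ![0, 1], ![-1, 0], ![0, -1]]

/-- **The twisted non-backtracking step matrix** `T_σ`: `T_σ(a,b) = 0` if `e_b = -e_a` (immediate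
reversal) and otherwise `e^{-iσ θ(a,b)}`, `θ(a,b) = turning (-e_a) 0 e_b ∈ {0, ±π/2}` the signed
turning angle from direction `a` to direction `b`; the one-step twisted two-point matrix
(`D(y)(a,b) = T_σ(a,b) 𝟙[y = e_b]`). [cite: DuminilCopinSmirnov2012, Def. 1 (the weight e^{-iσW} of one turn)] -/
def twistedStepMatrix (σ : ℝ) : Matrix (Fin 4) (Fin 4) ℂ :=
  Matrix.of fun a b => if stepDir b = -stepDir a then 0 else
    Complex.exp (-Complex.I * σ *
      (turning (-Site.toComplex (stepDir a)) 0 (Site.toComplex (stepDir b)) : ℝ))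

/-- The polyline `ω(0), ω(1), …, ω(n)` of the first `n` steps of a walk, in `ℂ`. [folklore] -/
def polyline (n : ℕ) (ω : ℕ → Site 2) : List ℂ :=
  (List.range (n + 1)).map fun i => Site.toComplex (ω i)

/-- `W_ι(ω)`: the total turning (radians, counter-clockwise positive) of the polyline
`-e_ι, ω(0), ω(1), …, ω(n)` — the winding of the `n`-step walk `ω` from `0` INCLUDING the turn at
`ω(0) = 0` from the fictitious incoming direction `e_ι` to the first step.
[cite: DuminilCopinSmirnov2012, §2 (winding `W_γ`)] -/
def twistedWinding (ι : Fin 4) (n : ℕ) (ω : ℕ → Site 2) : ℝ :=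
  winding ((-Site.toComplex (stepDir ι)) :: polyline n ω)

/-- The complex memory-2 (parafermionic) weight `e^{-iσ W_ι(ω)}` of an `n`-step walk with fictitious
incoming direction `ι`. [cite: DuminilCopinSmirnov2012, Def. 1] -/
def twistedWeight (σ : ℝ) (ι : Fin 4) (n : ℕ) (ω : ℕ → Site 2) : ℂ :=
  Complex.exp (-Complex.I * σ * (twistedWinding ι n ω : ℝ))

/-! ### Non-backtracking walks with direction labels -/

/-- The direction-label constraints on an `n`-step walk `ω` from `0`: NON-BACKTRACKING INCLUDING THE
FICTITIOUS INCOMING STEP `ι` — `ω(1) ≠ -e_ι` and `ω(i+2) ≠ ω(i)` for `i + 2 ≤ n` — and LAST STEP `e_κ`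
(`ω(n) - ω(n-1) = e_κ`, impossible for `n = 0`). These are the walks counted by Fitzner–van der
Hofstad's `b_n^ι(x)` (non-backtracking walks with a forbidden first step, there labelled by the
forbidden direction `e_ι` itself rather than by the incoming direction `-e_ι`), refined by the last
step. [cite: FitznerVanDerHofstad2016NoBLE, §1.2.2 (b_n^ι and eq. (1.10))] -/
def IsNBLabelled (ι κ : Fin 4) (n : ℕ) (ω : ℕ → Site 2) : Prop :=
  ω 1 ≠ -stepDir ι ∧ (∀ i ∈ Finset.range (n - 1), ω (i + 2) ≠ ω i) ∧ ω n - ω (n - 1) = stepDir κ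

/-- The label constraints are decidable (finitely many comparisons in `ℤ²`; classical instance). [folklore] -/
instance IsNBLabelled.decidable (ι κ : Fin 4) (n : ℕ) : DecidablePred (IsNBLabelled ι κ n) :=
  fun _ => Classical.dec _

/-- `𝒲ᴺᴮ_n(0,z)_{ι,κ}`: the `n`-step nearest-neighbour walks `ω : 0 → z` on `ℤ²` (vertex functions,
`walkFun 2 n z`) which are non-backtracking including the fictitious incoming step `ι` and whose
last step is `e_κ` (`IsNBLabelled ι κ n`); empty for `n = 0`.
[cite: FitznerVanDerHofstad2016NoBLE, §1.2.2 (b_n^ι and eq. (1.10))] -/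
def nbWalkFun (ι κ : Fin 4) (n : ℕ) (z : Site 2) : Finset (ℕ → Site 2) :=
  (walkFun 2 n z).filter (IsNBLabelled ι κ n)

/-! ### The twisted lace coefficients and the twisted two-point matrix -/

/-- **`Π^{σ,(N)}_n(z)`, the `N`-loop twisted lace coefficient** (matrix in the direction labels):
entry `(ι,κ)` is
`Σ_{ω ∈ 𝒲ᴺᴮ_n(0,z)_{ι,κ}} e^{-iσ W_ι(ω)} Σ_{L ∈ ℒ^{(N)}[0,n]} ∏_{st ∈ L} 𝟙[ω(s) = ω(t)] ∏_{s't' ∈ 𝒞(L)} (1 - 𝟙[ω(s') = ω(t')])`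
— Slade's (3.23) (`-𝒰_{st} = 𝟙[ω(s)=ω(t)]`, `1 + 𝒰 = 1 - 𝟙[·]`, the summand of `piN` at `λ = 1`)
with the walk sum replaced by the twisted non-backtracking one, matrix-valued in the direction
labels in the manner of the NoBLE coefficients `Π_z^{ι,κ}` (Fitzner–van der Hofstad (1.25), (1.29);
here `ι` = incoming direction at `0`, `κ` = last step, no activity variable: one matrix per length
`n`). [cite: Slade2006LaceExpansion, eq. (3.23)] -/
def twistedLaceCoefficientN (σ : ℝ) (N n : ℕ) (z : Site 2) : Matrix (Fin 4) (Fin 4) ℂ :=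
  Matrix.of fun ι κ => ∑ ω ∈ nbWalkFun ι κ n z, twistedWeight σ ι n ω *
    ((∑ L ∈ (laces 0 n).filter (fun L => L.card = N),
      (∏ e ∈ L, -interaction 1 ω e.1 e.2) * ∏ e ∈ compat 0 n L, (1 + interaction 1 ω e.1 e.2) : ℝ) : ℂ)

/-- **`Π^σ_n(z)`, the twisted lace coefficient** (the twisted self-energy at length `n`): entry
`(ι,κ)` is the signed lace sum
`Σ_{ω ∈ 𝒲ᴺᴮ_n(0,z)_{ι,κ}} e^{-iσ W_ι(ω)} Σ_{L ∈ ℒ[0,n]} ∏_{st ∈ L} U_{st}(ω) ∏_{s't' ∈ 𝒞(L)} (1 + U_{s't'}(ω))`,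
`U_{st} = -𝟙[ω(s) = ω(t)]`, i.e. `Σ_ω e^{-iσW_ι(ω)} J[0,n](ω)` (`twistedLaceCoefficient_apply`) and
`Σ_N (-1)^N Π^{σ,(N)}_n(z)` (`twistedLaceCoefficient_eq_sum`).
[cite: Slade2006LaceExpansion, eqs. (3.13), (3.19), (3.25)] -/
def twistedLaceCoefficient (σ : ℝ) (n : ℕ) (z : Site 2) : Matrix (Fin 4) (Fin 4) ℂ :=
  Matrix.of fun ι κ => ∑ ω ∈ nbWalkFun ι κ n z, twistedWeight σ ι n ω *
    ((∑ L ∈ laces 0 n, weight (interaction 1 ω) L *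
      ∏ e ∈ compat 0 n L, (1 + interaction 1 ω e.1 e.2) : ℝ) : ℂ)

/-- **`G^σ_n(z)`, the twisted two-point matrix**: for `n ≥ 1`, entry `(ι,κ)` is
`Σ_{ω ∈ 𝒲ᴺᴮ_n(0,z)_{ι,κ}} e^{-iσ W_ι(ω)} K[0,n](ω)` with `K[0,n] = ∏_{s<t}(1 + U_{st}) = 𝟙[ω is
self-avoiding]`, i.e. the sum of `e^{-iσW_ι}` over the `n`-step self-avoiding walks `0 → z` with first
step `≠ -e_ι` and last step `e_κ`; `G^σ_0(z) = δ_{0,z} I`. (Slade (3.12) with the twisted walk sum;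
the `G` of route `SAWTwistedSelfEnergy`.) [cite: Slade2006LaceExpansion, eq. (3.12)] -/
def twistedTwoPoint (σ : ℝ) (n : ℕ) (z : Site 2) : Matrix (Fin 4) (Fin 4) ℂ :=
  Matrix.of fun ι κ => if n = 0 then (if z = 0 ∧ ι = κ then 1 else 0) else
    ∑ ω ∈ nbWalkFun ι κ n z, twistedWeight σ ι n ω * ((K (interaction 1 ω) 0 n : ℝ) : ℂ)

/-! ### API -/

/-- The twisted weight is unimodular. [folklore] -/
theorem norm_twistedWeight (σ : ℝ) (ι : Fin 4) (n : ℕ) (ω : ℕ → Site 2) :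
    ‖twistedWeight σ ι n ω‖ = 1 := by
  rw [twistedWeight, Complex.norm_exp]
  simp

/-- No non-backtracking walk outside the box: `𝒲ᴺᴮ_n(0,z) = ∅` for `z ∉ {-n,…,n}²`. [folklore] -/
theorem nbWalkFun_eq_empty {ι κ : Fin 4} {n : ℕ} {z : Site 2} (hz : z ∉ box 2 n) :
    nbWalkFun ι κ n z = ∅ := by
  rw [nbWalkFun, walkFun_eq_empty hz, Finset.filter_empty]

/-- `𝒲ᴺᴮ_n(0,z)_{ι,κ} ⊆ 𝒲_n(0,z)`. [folklore] -/
theorem nbWalkFun_subset (ι κ : Fin 4) (n : ℕ) (z : Site 2) : nbWalkFun ι κ n z ⊆ walkFun 2 n z :=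
  Finset.filter_subset _ _

/-- There is no `0`-step walk with a last step: `𝒲ᴺᴮ_0 = ∅`. [folklore] -/
theorem nbWalkFun_zero (ι κ : Fin 4) (z : Site 2) : nbWalkFun ι κ 0 z = ∅ := by
  refine Finset.filter_false_of_mem fun ω _ h => ?_
  have h0 : (0 : Site 2) = stepDir κ := by simpa using h.2.2
  have h₀ := congrFun h0 0
  have h₁ := congrFun h0 1
  fin_cases κ <;> simp [stepDir] at h₀ h₁

/-- **Resummation**: `Π^σ_n(z)(ι,κ) = Σ_{ω ∈ 𝒲ᴺᴮ_n(0,z)_{ι,κ}} e^{-iσW_ι(ω)} J[0,n](ω)` — the signed lace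
sum is the connected-graph sum `J[0,n]` (Slade (3.19), `J_eq_sum_laces`).
[cite: Slade2006LaceExpansion, eqs. (3.13), (3.19)] -/
theorem twistedLaceCoefficient_apply (σ : ℝ) (n : ℕ) (z : Site 2) (ι κ : Fin 4) :
    twistedLaceCoefficient σ n z ι κ =
      ∑ ω ∈ nbWalkFun ι κ n z, twistedWeight σ ι n ω * ((J (interaction 1 ω) 0 n : ℝ) : ℂ) := by
  simp only [twistedLaceCoefficient, Matrix.of_apply, J_eq_sum_laces]

/-- **(3.25) twisted**: `Π^σ_n(z) = Σ_{N=0}^{n} (-1)^N Π^{σ,(N)}_n(z)` (`∏_{st∈L} U_{st} =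
(-1)^{|L|} ∏_{st∈L} (-U_{st})`, laces grouped by their number of edges `|L| ≤ n`; the term `N = 0`
vanishes). [cite: Slade2006LaceExpansion, eqs. (3.21)–(3.25)] -/
theorem twistedLaceCoefficient_eq_sum (σ : ℝ) (n : ℕ) (z : Site 2) :
    twistedLaceCoefficient σ n z =
      ∑ N ∈ Finset.range (n + 1), (-1 : ℂ) ^ N • twistedLaceCoefficientN σ N n z := by
  have key : ∀ ω : ℕ → Site 2,
      (∑ L ∈ laces 0 n, weight (interaction 1 ω) L *
          ∏ e ∈ compat 0 n L, (1 + interaction 1 ω e.1 e.2)) =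
        ∑ N ∈ Finset.range (n + 1), (-1) ^ N * ∑ L ∈ (laces 0 n).filter (fun L => L.card = N),
          (∏ e ∈ L, -interaction 1 ω e.1 e.2) * ∏ e ∈ compat 0 n L, (1 + interaction 1 ω e.1 e.2) := by
    intro ω
    rw [← Finset.sum_fiberwise_of_maps_to (s := laces 0 n) (t := Finset.range (n + 1))
      (g := Finset.card) fun L hL => Finset.mem_range.2
        (Nat.lt_succ_of_le ((card_le_of_mem_laces hL).trans (Nat.sub_zero n).le))]
    refine Finset.sum_congr rfl fun N _ => ?_
    rw [Finset.mul_sum]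
    refine Finset.sum_congr rfl fun L hL => ?_
    rw [Finset.mem_filter] at hL
    rw [weight, ← hL.2, ← mul_assoc, ← Finset.prod_neg]
    simp only [neg_neg]
  ext ι κ
  simp only [twistedLaceCoefficient, twistedLaceCoefficientN, Matrix.sum_apply, Matrix.smul_apply,
    Matrix.of_apply, smul_eq_mul, key]
  push_cast
  simp_rw [Finset.mul_sum]
  rw [Finset.sum_comm]
  refine Finset.sum_congr rfl fun N _ => Finset.sum_congr rfl fun ω _ =>
    Finset.sum_congr rfl fun L _ => ?_
  ring

/-- **`|Π^{σ,(N)}_n(z)(ι,κ)| ≤ π_n^{(N)}(z)`**: each twisted entry is bounded by the untwisted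
simple-random-walk-reference coefficient `piN 2 1 N n z` of `LaceExpansionPiN.lean` (unimodular
weights, non-negative lace factors (3.24), and `𝒲ᴺᴮ ⊆ 𝒲`), so that every diagrammatic bound on
`π^{(N)}` bounds `Π^{σ,(N)}`. [cite: Slade2006LaceExpansion, eq. (3.24)] -/
theorem norm_twistedLaceCoefficientN_le_piN (σ : ℝ) (N n : ℕ) (z : Site 2) (ι κ : Fin 4) :
    ‖twistedLaceCoefficientN σ N n z ι κ‖ ≤ piN 2 1 N n z := by
  rw [twistedLaceCoefficientN, Matrix.of_apply, piN]
  have hnn : ∀ ω : ℕ → Site 2, 0 ≤ ∑ L ∈ (laces 0 n).filter (fun L => L.card = N),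
      (∏ e ∈ L, -interaction 1 ω e.1 e.2) * ∏ e ∈ compat 0 n L, (1 + interaction 1 ω e.1 e.2) :=
    fun ω => Finset.sum_nonneg fun _ _ =>
      mul_nonneg (Finset.prod_nonneg fun _ _ => neg_interaction_nonneg zero_le_one ω _ _)
        (Finset.prod_nonneg fun _ _ => (one_add_interaction_mem zero_le_one le_rfl ω _ _).1)
  refine (norm_sum_le _ _).trans ?_
  calc ∑ ω ∈ nbWalkFun ι κ n z, ‖twistedWeight σ ι n ω *
          ((∑ L ∈ (laces 0 n).filter (fun L => L.card = N), (∏ e ∈ L, -interaction 1 ω e.1 e.2) *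
            ∏ e ∈ compat 0 n L, (1 + interaction 1 ω e.1 e.2) : ℝ) : ℂ)‖
        = ∑ ω ∈ nbWalkFun ι κ n z, ∑ L ∈ (laces 0 n).filter (fun L => L.card = N),
            (∏ e ∈ L, -interaction 1 ω e.1 e.2) * ∏ e ∈ compat 0 n L, (1 + interaction 1 ω e.1 e.2) := by
          refine Finset.sum_congr rfl fun ω _ => ?_
          rw [norm_mul, norm_twistedWeight, one_mul, Complex.norm_real, Real.norm_of_nonneg (hnn ω)]
    _ ≤ _ := Finset.sum_le_sum_of_subset_of_nonneg (nbWalkFun_subset ι κ n z) fun ω _ _ => hnn ω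

/-- Support: `Π^{σ,(N)}_n(z) = 0` unless `z ∈ {-n,…,n}²`. [folklore] -/
theorem twistedLaceCoefficientN_eq_zero_of_notMem_box (σ : ℝ) (N : ℕ) {n : ℕ} {z : Site 2}
    (hz : z ∉ box 2 n) : twistedLaceCoefficientN σ N n z = 0 := by
  ext ι κ
  simp [twistedLaceCoefficientN, nbWalkFun_eq_empty hz]

/-- Support: `Π^σ_n(z) = 0` unless `z ∈ {-n,…,n}²` (the kernel at length `n` lives in the box of
radius `n`). [folklore] -/
theorem twistedLaceCoefficient_eq_zero_of_notMem_box (σ : ℝ) {n : ℕ} {z : Site 2}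
    (hz : z ∉ box 2 n) : twistedLaceCoefficient σ n z = 0 := by
  ext ι κ
  simp [twistedLaceCoefficient, nbWalkFun_eq_empty hz]

/-- Support: `G^σ_n(z) = 0` unless `z ∈ {-n,…,n}²`. [folklore] -/
theorem twistedTwoPoint_eq_zero_of_notMem_box (σ : ℝ) {n : ℕ} {z : Site 2}
    (hz : z ∉ box 2 n) : twistedTwoPoint σ n z = 0 := by
  ext ι κ
  have hz0 : z ≠ 0 := by
    rintro rfl
    exact hz (by simp [mem_box])
  simp [twistedTwoPoint, nbWalkFun_eq_empty hz, hz0]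

/-- `Π^σ_0 = 0` (no lace on `[0,0]`, no walk with a last step). [folklore] -/
theorem twistedLaceCoefficient_zero (σ : ℝ) (z : Site 2) : twistedLaceCoefficient σ 0 z = 0 := by
  ext ι κ
  simp [twistedLaceCoefficient, nbWalkFun_zero]

/-- `Π^{σ,(N)}_0 = 0`. [folklore] -/
theorem twistedLaceCoefficientN_zero (σ : ℝ) (N : ℕ) (z : Site 2) :
    twistedLaceCoefficientN σ N 0 z = 0 := by
  ext ι κ
  simp [twistedLaceCoefficientN, nbWalkFun_zero]

/-- `Π^σ_1 = 0`: the only connected graph on `[0,1]` is `{01}` and `U_{01}(ω) = 0` since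
`ω(0) ≠ ω(1)` (Slade, §3.3, remark on `m = 1`). [cite: Slade2006LaceExpansion, §3.3 (`π₁ = 0`)] -/
theorem twistedLaceCoefficient_one (σ : ℝ) (z : Site 2) : twistedLaceCoefficient σ 1 z = 0 := by
  ext ι κ
  rw [twistedLaceCoefficient_apply, Matrix.zero_apply]
  refine Finset.sum_eq_zero fun ω hω => ?_
  have hω' : ω ∈ walkFun 2 1 z := nbWalkFun_subset ι κ 1 z hω
  have hJ : J (interaction 1 ω) 0 1 = 0 := by
    refine Finset.sum_eq_zero fun Γ hΓ => ?_
    obtain ⟨hsub, ⟨e, he, he1⟩, -⟩ := mem_connGraphs.1 hΓ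
    have he' := mem_edges.1 (hsub he)
    have he2 : e.2 = 1 := by omega
    obtain ⟨-, -, hadj⟩ := mem_walkFun.1 hω'
    have hne : ω 0 ≠ ω 1 := (zdGraph 2).ne_of_adj (hadj 0 Nat.one_pos)
    refine Finset.prod_eq_zero he ?_
    rw [interaction, he1, he2, if_neg hne, mul_zero, neg_zero]
  rw [hJ, Complex.ofReal_zero, mul_zero]

end Literature.Probability.RandomPlanarGeometry.LaceExpansion
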